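import Summits.KontsevichZagierPeriods.KontsevichZagierPeriods.Theses.HurwitzMicroSectors
import Summits.KontsevichZagierPeriods.KontsevichZagierPeriods.Theorems.HurwitzMicroSectorsNormalFormPrinciplePiBoxTransfer
import Summits.KontsevichZagierPeriods.KontsevichZagierPeriods.Theorems.HurwitzMicroSectorsNormalFormPrincipleVariants2215
import Summits.KontsevichZagierPeriods.KontsevichZagierPeriods.Theorems.HurwitzMicroSectorsNormalFormPrincipleVariants2239
import Summits.KontsevichZagierPeriods.KontsevichZagierPeriods.Theorems.HurwitzMicroSectorsNormalFormPrincipleVariants2293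

/-! TTRL-lite variant V2289 of stmt-KontsevichZagierPeriods-3869

Variant V2289 = `stub_boxRigidity` (the leaf `BoxRigidity` of `NormalFormPrinciple`: two BOX-RATIONAL
representations — domain the open unit box, integrand `p/q` over `ℚ`, `q ≠ 0` on the box — with equal
values are KZ-equivalent) with BOTH dimensions frozen, `fix_nat:m=5; fix_nat:m'=4`. Verdict of the
attempt seat: **open** — this file is the exact-strength certificate, not a proof of the variant.
* `V2289 ⟺ BoxVanishing 5` (`stub_boxRigidity_var2289_iff_boxVanishing_five`): instance `(j, k) = (5, 4)`
  of the tree's `boxRigidityFix_iff_boxVanishing_fst` (file `…Variants2215`: two frozen dimensions are the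
  larger one — forward, compare a vanishing representation on `(0,1)⁵` with the zero representation on
  `(0,1)⁴`, itself a relation; backward, pad the `4`-dimensional representation to `(0,1)⁵` by a unit
  interval, `pad_le`, subtract on the common box, `sub_same`, value `0` by soundness);
* hence `V2289 ⟺ BoxRigidity(m, m' ≤ 5) ⟺ V2293 ⟺ V2283` (`…_iff_le_five`, `…_iff_var2293`,
  `…_iff_var2283`): the frozen value `m' = 4` is idle, V2289 coincides with every sibling of maximal
  dimension `5`, and it implies the frozen sibling V2271 (`(4, 4)` = BoxVanishing 4,
  `boxRigidity_four_four_of_stub_boxRigidity_var2289`) and BoxVanishing in every dimension `≤ 5`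
  (`boxVanishing_le_five_of_stub_boxRigidity_var2289`);
* `KontsevichZagierPeriods ⟹ parent leaf ⟹ V2289` (`stub_boxRigidity_var2289_of_statement`,
  `stub_boxRigidity_var2289_of_parent`), so a refutation of V2289 would refute the Summit; the tree has no
  invariant of `KZ.relations` finer than `eval` (soundness) with which to attempt one
  (`KZSubcalculusInvariants` only separates proper sub-calculi).
Why open: BoxVanishing 5 contains BoxVanishing 2, i.e. every vanishing absolutely convergent
`∫∫_{(0,1)²} p/q` (`p, q ∈ ℚ[x, y]`, `q ≠ 0` on the open square) is generated by the four moves; for the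
family `[(0,1)², 1/(1+x²y²) − c]` of value `G − c` (`G` = Catalan's constant, `c : ℚ`) a chain of moves at
`c` forces `G = c` by soundness, so a proof must refute `G = c` for every rational `c` but at most one
explicit `c₀` — an irrationality theorem for `G`, open (likewise `ζ(5) = ∫_{(0,1)⁵} dx/(1 − x₁⋯x₅)` against
rational constants in dimension `5`). The tree's knowledge stops at `m, m' ≤ 1` (`boxRigidity_of_le_one`,
Baker, file `…BoxRigidityDimOne`). Residual goal: `BoxVanishing 5`.
Source: M. Kontsevich, D. Zagier, *Periods* (2001), §1.2 Conjecture 1 and rules 1)–3).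
Pure proof file, no definitions. -/

-- `Summit.<Summit>.<Problem>` is the tree's mandated summit-side namespace (CONVENTIONS §2); for this
-- single-conjunct summit the two coincide, so the duplicate is deliberate.
set_option linter.dupNamespace false

noncomputable section

namespace Summit.KontsevichZagierPeriods.KontsevichZagierPeriods.Theorems

open MeasureTheory Set
open Literature.NumberTheory.Transcendental Literature.NumberTheory.Transcendental.KZ
open Summit.KontsevichZagierPeriods.KontsevichZagierPeriods.Theses.HurwitzMicroSectors
open Summit.KontsevichZagierPeriods.HurwitzMicroSectors.NormalFormPrinciple.PiBox

/-! ## The variant V2289 is exactly `BoxVanishing 5` -/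

/-- **V2289 ⟺ BoxVanishing in dimension `5`** (every box-rational representation on `(0,1)⁵` of value
`0` is a KZ relation): instance `(j, k) = (5, 4)` of `boxRigidityFix_iff_boxVanishing_fst` — forward by
comparison with the zero representation on `(0,1)⁴`, backward by padding to `(0,1)⁵` and subtracting.
[cite: KontsevichZagier2001, §1.2 Conjecture 1] -/
theorem stub_boxRigidity_var2289_iff_boxVanishing_five :
    (∀ (N : IntegralRep 5) (N' : IntegralRep 4), N.domain = {x | ∀ i, x i ∈ Set.Ioo (0:ℝ) 1} → N.IsRational → N'.domain = {x | ∀ i, x i ∈ Set.Ioo (0:ℝ) 1} → N'.IsRational → N.value = N'.value → Equivalent N N') ↔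
    (∀ (N : IntegralRep 5), N.domain = {x | ∀ i, x i ∈ Set.Ioo (0:ℝ) 1} → N.IsRational →
      N.value = 0 → of N ∈ relations) :=
  boxRigidityFix_iff_boxVanishing_fst (by norm_num)

/-- **V2289 ⟺ BoxRigidity under the joint bound `m, m' ≤ 5`** (the honest strength of the variant:
Conjecture 1 for all pairs of rational integrands on the open unit boxes of dimension at most `5`; the
frozen values `5`, `4` matter only through the larger one). [cite: KontsevichZagier2001, §1.2 Conjecture 1] -/
theorem stub_boxRigidity_var2289_iff_le_five :
    (∀ (N : IntegralRep 5) (N' : IntegralRep 4), N.domain = {x | ∀ i, x i ∈ Set.Ioo (0:ℝ) 1} → N.IsRational → N'.domain = {x | ∀ i, x i ∈ Set.Ioo (0:ℝ) 1} → N'.IsRational → N.value = N'.value → Equivalent N N') ↔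
    (∀ (m m' : ℕ) (N : IntegralRep m) (N' : IntegralRep m'), m' ≤ 5 → m ≤ 5 →
      N.domain = {x | ∀ i, x i ∈ Set.Ioo (0:ℝ) 1} → N.IsRational →
      N'.domain = {x | ∀ i, x i ∈ Set.Ioo (0:ℝ) 1} → N'.IsRational →
      N.value = N'.value → Equivalent N N') :=
  ⟨fun h => boxRigidityLe_of_boxVanishing (j := 5) (k := 5) le_rfl le_rfl
      (stub_boxRigidity_var2289_iff_boxVanishing_five.1 h),
    fun h N N' => h 5 4 N N' (by norm_num) le_rfl⟩

/-- **V2289 ⟺ the sibling V2293** (`fix_nat:m=5; bound_nat:m'≤5`): both are `BoxVanishing 5`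
(`stub_boxRigidity_var2293_iff_boxVanishing_five`, file `…Variants2293`). [cite: KontsevichZagier2001, §1.2 Conjecture 1] -/
theorem stub_boxRigidity_var2289_iff_var2293 :
    (∀ (N : IntegralRep 5) (N' : IntegralRep 4), N.domain = {x | ∀ i, x i ∈ Set.Ioo (0:ℝ) 1} → N.IsRational → N'.domain = {x | ∀ i, x i ∈ Set.Ioo (0:ℝ) 1} → N'.IsRational → N.value = N'.value → Equivalent N N') ↔
    (∀ (m' : ℕ) (N : IntegralRep 5) (N' : IntegralRep m'), m' ≤ 5 → N.domain = {x | ∀ i, x i ∈ Set.Ioo (0:ℝ) 1} → N.IsRational → N'.domain = {x | ∀ i, x i ∈ Set.Ioo (0:ℝ) 1} → N'.IsRational → N.value = N'.value → Equivalent N N') :=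
  stub_boxRigidity_var2289_iff_boxVanishing_five.trans
    stub_boxRigidity_var2293_iff_boxVanishing_five.symm

/-- **V2289 ⟺ the sibling V2283** (`fix_nat:m=5; fix_nat:m'=2`): both are `BoxVanishing 5`
(`stub_boxRigidity_var2283_iff_boxVanishing_five`, file `…Variants2283`) — the frozen right dimension
(`4` here, `2` there) is idle below `5`. [cite: KontsevichZagier2001, §1.2 Conjecture 1] -/
theorem stub_boxRigidity_var2289_iff_var2283 :
    (∀ (N : IntegralRep 5) (N' : IntegralRep 4), N.domain = {x | ∀ i, x i ∈ Set.Ioo (0:ℝ) 1} → N.IsRational → N'.domain = {x | ∀ i, x i ∈ Set.Ioo (0:ℝ) 1} → N'.IsRational → N.value = N'.value → Equivalent N N') ↔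
    (∀ (N : IntegralRep 5) (N' : IntegralRep 2), N.domain = {x | ∀ i, x i ∈ Set.Ioo (0:ℝ) 1} → N.IsRational → N'.domain = {x | ∀ i, x i ∈ Set.Ioo (0:ℝ) 1} → N'.IsRational → N.value = N'.value → Equivalent N N') :=
  stub_boxRigidity_var2289_iff_boxVanishing_five.trans
    stub_boxRigidity_var2283_iff_boxVanishing_five.symm

/-! ## Downward consequences -/

/-- **V2289 ⇒ BoxVanishing in every dimension `≤ 5`** (monotonicity along padding, `boxVanishing_mono`);
the first open level is `2` (every vanishing absolutely convergent `∫∫_{(0,1)²} p/q`, `p/q ∈ ℚ(x, y)`, is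
generated by the four moves: the Catalan family `[(0,1)², 1/(1+x²y²) − c]`).
[cite: KontsevichZagier2001, §1.2 Conjecture 1] -/
theorem boxVanishing_le_five_of_stub_boxRigidity_var2289
    (h : ∀ (N : IntegralRep 5) (N' : IntegralRep 4), N.domain = {x | ∀ i, x i ∈ Set.Ioo (0:ℝ) 1} → N.IsRational → N'.domain = {x | ∀ i, x i ∈ Set.Ioo (0:ℝ) 1} → N'.IsRational → N.value = N'.value → Equivalent N N')
    {m : ℕ} (hm : m ≤ 5) (N : IntegralRep m) (hNd : N.domain = {x | ∀ i, x i ∈ Set.Ioo (0:ℝ) 1})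
    (hNr : N.IsRational) (hv : N.value = 0) : of N ∈ relations :=
  boxVanishing_mono hm (stub_boxRigidity_var2289_iff_boxVanishing_five.1 h) N hNd hNr hv

/-- **V2289 ⇒ the frozen sibling V2271** (`fix_nat:m=4; fix_nat:m'=4`, i.e. BoxVanishing 4): pad both
`4`-dimensional representations to `(0,1)⁵` and subtract (`boxRigidityFix_of_boxVanishing`). The converse
is not claimed (BoxVanishing `4 ⇒ 5` is not known). [cite: KontsevichZagier2001, §1.2 Conjecture 1] -/
theorem boxRigidity_four_four_of_stub_boxRigidity_var2289
    (h : ∀ (N : IntegralRep 5) (N' : IntegralRep 4), N.domain = {x | ∀ i, x i ∈ Set.Ioo (0:ℝ) 1} → N.IsRational → N'.domain = {x | ∀ i, x i ∈ Set.Ioo (0:ℝ) 1} → N'.IsRational → N.value = N'.value → Equivalent N N') :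
    ∀ (N : IntegralRep 4) (N' : IntegralRep 4), N.domain = {x | ∀ i, x i ∈ Set.Ioo (0:ℝ) 1} → N.IsRational →
      N'.domain = {x | ∀ i, x i ∈ Set.Ioo (0:ℝ) 1} → N'.IsRational →
      N.value = N'.value → Equivalent N N' :=
  boxRigidityFix_of_boxVanishing (by norm_num) (by norm_num)
    (stub_boxRigidity_var2289_iff_boxVanishing_five.1 h)

/-- **V2289, mirrored** (`(m, m') = (4, 5)`): `Equivalent` is symmetric, so the frozen pair may be read in
either order; both orders are `BoxVanishing 5`. [cite: KontsevichZagier2001, §1.2 Conjecture 1] -/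
theorem stub_boxRigidity_var2289_iff_swap :
    (∀ (N : IntegralRep 5) (N' : IntegralRep 4), N.domain = {x | ∀ i, x i ∈ Set.Ioo (0:ℝ) 1} → N.IsRational → N'.domain = {x | ∀ i, x i ∈ Set.Ioo (0:ℝ) 1} → N'.IsRational → N.value = N'.value → Equivalent N N') ↔
    (∀ (N : IntegralRep 4) (N' : IntegralRep 5), N.domain = {x | ∀ i, x i ∈ Set.Ioo (0:ℝ) 1} → N.IsRational →
      N'.domain = {x | ∀ i, x i ∈ Set.Ioo (0:ℝ) 1} → N'.IsRational →
      N.value = N'.value → Equivalent N N') :=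
  ⟨fun h N N' hNd hNr hN'd hN'r hv => (h N' N hN'd hN'r hNd hNr hv.symm).symm,
    fun h N N' hNd hNr hN'd hN'r hv => (h N' N hN'd hN'r hNd hNr hv.symm).symm⟩

/-! ## Upper bounds: the parent leaf and the Summit imply V2289 -/

/-- **The parent leaf ⇒ V2289** (specialisation `m := 5`, `m' := 4`; the converse is not claimed — the
parent is `BoxVanishing` in ALL dimensions, the variant only in dimension `5`).
[cite: KontsevichZagier2001, §1.2 Conjecture 1] -/
theorem stub_boxRigidity_var2289_of_parent
    (h : ∀ (m m' : ℕ) (N : IntegralRep m) (N' : IntegralRep m'), N.domain = {x | ∀ i, x i ∈ Set.Ioo (0:ℝ) 1} → N.IsRational → N'.domain = {x | ∀ i, x i ∈ Set.Ioo (0:ℝ) 1} → N'.IsRational → N.value = N'.value → Equivalent N N') :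
    ∀ (N : IntegralRep 5) (N' : IntegralRep 4), N.domain = {x | ∀ i, x i ∈ Set.Ioo (0:ℝ) 1} → N.IsRational → N'.domain = {x | ∀ i, x i ∈ Set.Ioo (0:ℝ) 1} → N'.IsRational → N.value = N'.value → Equivalent N N' :=
  fun N N' => h 5 4 N N'

/-- **`KontsevichZagierPeriods ⇒ V2289`**: the variant is a special case of Conjecture 1 for the tree's
calculus (`leaves_of_statement`) — so a refutation of the variant would refute the Summit.
[cite: KontsevichZagier2001, §1.2 Conjecture 1] -/
theorem stub_boxRigidity_var2289_of_statement (h : _root_.KontsevichZagierPeriods) :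
    ∀ (N : IntegralRep 5) (N' : IntegralRep 4), N.domain = {x | ∀ i, x i ∈ Set.Ioo (0:ℝ) 1} → N.IsRational → N'.domain = {x | ∀ i, x i ∈ Set.Ioo (0:ℝ) 1} → N'.IsRational → N.value = N'.value → Equivalent N N' :=
  stub_boxRigidity_var2289_of_parent (leaves_of_statement h).1

end Summit.KontsevichZagierPeriods.KontsevichZagierPeriods.Theorems

end
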